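import Literature.AnabelianGeometry.EtaleTheta.RealifiedDivisorMonoidsOfRlfWeak
import Literature.AnabelianGeometry.EtaleTheta.Discharge.Sec3Lemma35HoldsWeak
import Literature.AlgebraicGeometry.Frobenioids.PerfFactorialProductCounterexample
import HarnessLib

/-!
# [EtTh] Def. 3.6 (i) at infinitely many special-fibre components: the weak constructor `ofRlfZWeak` is
# INHABITED where the printed-vocabulary constructor `ofRlfZ` is VACUOUS (non-vacuity witness)

Mochizuki, *The étale theta function …*, Publ. RIMS **45** (2009), Def. 3.3 (iii) p.73 (the data
`(Φ₀, B₀, B₀ → Φ₀^gp, F₀ ⊆ B₀)`), Prop. 3.2 (i) p.70 / Rmk 3.3.1 (the primes of `Φ₀(Y^log)` = orbits of prime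
log-divisors, so that at a covering with infinitely many special-fibre components — `Ÿ`, `Z_∞`, the
objects of §§4–5 — `Φ₀(Y^log)` contains `∏_j ℤ_{≥0}`), Prop. 3.4 (i) p.74 ("`Φ₀(Y^log)` is perf-factorial"),
Def. 3.6 (i) p.76 ("`Φ₀^ℝ := Φ₀^rlf` … [cf. Proposition 3.4, (i)]") [cite: MochizukiEtTh2009, Def 3.6 p.76].

Cell findings F-L2d2-1 / F-L2d2-2 (abc-iut-L2-d2): `∏_ℕ ℤ_{≥0}` is NOT perf-factorial as printed ([FrdI]
Def. 2.4 (i)(d) fails — kernel witness `PerfFactorialProductCounterexample.not_isPerfFactorial_multiplicative_pi_nat`)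
but IS "perf-factorial" in the repaired vocabulary `treeMonoidVocabWeak` (`IsPerfFactorialCof`,
`PiNat.isPerfFactorialCof`).  THIS FILE records the consequence for [EtTh] Def. 3.6 (i) on a degenerate
Def. 3.3 (iii) datum of exactly that shape (`Φ₀ := ∏_ℕ ℤ_{≥0}` constant over the one-object base, `B₀`
trivial, everything non-cuspidal — after abc-iut-L2-t3's `TemperedFrobenioidToy`):
* `piNatDivisorMonoids` — the datum;
* `not_forall_isPerfFactorial_piNat` — its divisor monoids are NOT perf-factorial as printed, so the
  hypothesis of abc-iut-L6-t12's printed-vocabulary constructor `RealifiedDivisorMonoids.ofRlfZ` (p412382)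
  is unsatisfiable here (`isEmpty_ofRlfZ_hypothesis_piNat`);
* `forall_isPerfFactorialCof_piNat` and **`ofRlfZWeakPiNat := ofRlfZWeak piNatDivisorMonoids _`** — the
  weak-vocabulary constructor (`RealifiedDivisorMonoidsOfRlfWeak.lean`) IS inhabited here, for all three
  monoid types (`nonempty_realifiedDivisorMonoids_weak_piNat`).
No statement of the paper is asserted; a satisfiability record.  Seat abc-iut-L6-t12 (cell abc-iut;
F-L2d2-1 / F-L2d2-2 repair chain, non-vacuity of piece (E)).  HONEST FRAMING: nothing here bears on
[IUTchIII] Cor. 3.12.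
-/

noncomputable section

namespace Literature.AnabelianGeometry.EtaleTheta

open CategoryTheory Opposite Literature.AlgebraicGeometry.Frobenioids

namespace OfRlfWeakPiNat

/-- **Def. 3.3 (iii) datum of the F-L2d2-1 shape**: `Φ₀ := ∏_ℕ ℤ_{≥0}` (infinitely many "special-fibre
components"), `B₀ :=` the trivial group, `B₀ → Φ₀^gp` trivial, `F₀ := B₀`, every log-divisor non-cuspidal,
over the one-object base category. [cite: MochizukiEtTh2009, Def 3.3 p.73] -/
def piNatDivisorMonoids : DivisorMonoids.{0, 0, 0} (Discrete PUnit.{1}) where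
  Φ₀ := (Functor.const _).obj (CommMonCat.of (Multiplicative (ℕ → ℕ)))
  B₀ := (Functor.const _).obj (CommMonCat.of PUnit.{1})
  isUnit_B₀ _ b := by
    change IsUnit (M := PUnit.{1}) b
    exact isUnit_of_subsingleton _
  div₀ _ := 1
  div₀_natural _ b := by rw [MonoidHom.one_apply, MonoidHom.one_apply, map_one]
  F₀ _ := ⊤
  F₀_map _ _ _ := trivial
  ncsp₀ _ := ⊤
  csp₀ _ := ⊥
  ncsp₀_map _ _ _ := trivial
  csp₀_map _ x hx := by
    rw [Submonoid.mem_bot] at hx ⊢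
    rw [hx, map_one]
  existsUnique_ncsp_csp _ x := by
    refine ⟨(⟨x, trivial⟩, ⟨1, Submonoid.mem_bot.mpr rfl⟩), mul_one x, ?_⟩
    rintro ⟨a, c⟩ h
    have hc : c.1 = 1 := Submonoid.mem_bot.mp c.2
    have ha : a.1 = x := by
      have h' : a.1 * c.1 = x := h
      rwa [hc, mul_one] at h'
    exact Prod.ext (Subtype.ext ha) (Subtype.ext hc)

/-- The divisor monoid of the datum at (the) object is `∏_ℕ ℤ_{≥0}`. [cite: MochizukiEtTh2009, Def 3.3 p.73] -/
theorem Φ₀_obj (Y : (Discrete PUnit.{1})ᵒᵖ) :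
    (piNatDivisorMonoids.Φ₀.obj Y : Type) = Multiplicative (ℕ → ℕ) := rfl

/-- **The printed Prop. 3.4 (i) FAILS for this datum**: `∏_ℕ ℤ_{≥0}` is not perf-factorial as printed
([FrdI] Def. 2.4 (i)(d); abc-iut-L2-d2's kernel witness). [cite: MochizukiEtTh2009, Prop 3.4 p.74] -/
theorem not_forall_isPerfFactorial_piNat :
    ¬ ∀ Y : (Discrete PUnit.{1})ᵒᵖ, IsPerfFactorial (piNatDivisorMonoids.Φ₀.obj Y) := fun h =>
  PerfFactorialProductCounterexample.not_isPerfFactorial_multiplicative_pi_nat (h (op ⟨PUnit.unit⟩))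

/-- Hence the hypothesis type of the printed-vocabulary constructor `RealifiedDivisorMonoids.ofRlfZ` is
EMPTY for this datum: `ofRlfZ piNatDivisorMonoids hpf` has no instance `hpf`.
[cite: MochizukiEtTh2009, Def 3.6 p.76] -/
theorem isEmpty_ofRlfZ_hypothesis_piNat :
    IsEmpty (∀ Y : (Discrete PUnit.{1})ᵒᵖ, IsPerfFactorial (piNatDivisorMonoids.Φ₀.obj Y)) :=
  ⟨not_forall_isPerfFactorial_piNat⟩

/-- **The repaired Prop. 3.4 (i) HOLDS for this datum**: `∏_ℕ ℤ_{≥0}` is weakly perf-factorial with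
cofinal perfection (abc-iut-L2-d2's `PiNat.isPerfFactorialCof`). [cite: MochizukiEtTh2009, Prop 3.4 p.74] -/
theorem forall_isPerfFactorialCof_piNat :
    ∀ Y : (Discrete PUnit.{1})ᵒᵖ, IsPerfFactorialCof (piNatDivisorMonoids.Φ₀.obj Y) := fun _ =>
  PiNat.isPerfFactorialCof ℕ

/-- **Def. 3.6 (i) data over the weak vocabulary EXIST for the F-L2d2-1 shape** (`Λ = ℤ`): the weak
constructor applied to the datum. [cite: MochizukiEtTh2009, Def 3.6 p.76] -/
def ofRlfZWeakPiNat : RealifiedDivisorMonoids (D₀ := Discrete PUnit.{1}) treeMonoidVocabWeak.{0} :=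
  RealifiedDivisorMonoids.ofRlfZWeak piNatDivisorMonoids forall_isPerfFactorialCof_piNat

/-- The same for `Λ = ℝ`. [cite: MochizukiEtTh2009, Def 3.6 p.76] -/
def ofRlfRWeakPiNat : RealifiedDivisorMonoids (D₀ := Discrete PUnit.{1}) treeMonoidVocabWeak.{0} :=
  RealifiedDivisorMonoids.ofRlfRWeak piNatDivisorMonoids forall_isPerfFactorialCof_piNat

/-- `ofRlfZWeakPiNat` keeps the datum and has monoid type `ℤ`. [cite: MochizukiEtTh2009, Def 3.6 p.76] -/
theorem ofRlfZWeakPiNat_spec :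
    ofRlfZWeakPiNat.toDivisorMonoids = piNatDivisorMonoids ∧ ofRlfZWeakPiNat.Λ = MonoidType.Z :=
  ⟨rfl, rfl⟩

/-- **Non-vacuity of [EtTh] Def. 3.6 (i) over `treeMonoidVocabWeak` at infinitely many components**, for
the monoid types `ℤ` and `ℝ`, over a datum whose printed-vocabulary Def. 3.6 (i) constructor is vacuous.
[cite: MochizukiEtTh2009, Def 3.6 p.76] -/
theorem nonempty_realifiedDivisorMonoids_weak_piNat :
    (∃ T : RealifiedDivisorMonoids (D₀ := Discrete PUnit.{1}) treeMonoidVocabWeak.{0},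
        T.toDivisorMonoids = piNatDivisorMonoids ∧ T.Λ = MonoidType.Z) ∧
      (∃ T : RealifiedDivisorMonoids (D₀ := Discrete PUnit.{1}) treeMonoidVocabWeak.{0},
        T.toDivisorMonoids = piNatDivisorMonoids ∧ T.Λ = MonoidType.R) ∧
      ¬ ∀ Y : (Discrete PUnit.{1})ᵒᵖ, IsPerfFactorial (piNatDivisorMonoids.Φ₀.obj Y) :=
  ⟨⟨ofRlfZWeakPiNat, rfl, rfl⟩, ⟨ofRlfRWeakPiNat, rfl, rfl⟩, not_forall_isPerfFactorial_piNat⟩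

end OfRlfWeakPiNat

end Literature.AnabelianGeometry.EtaleTheta

end
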